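import Summits.CriticalPhenomena.PercolationContinuityZ3.Theorems.PercNearOneGluingNoHeavyPcintThirdBondUnits
import Summits.CriticalPhenomena.PercolationContinuityZ3.Theorems.PercNearOneGluingNoHeavyPcintChainBondReduction
import HarnessLib

/-!
# PCINT lane, reduction B3t (`chordthird_cw`): `θ(p) ≤ Σ_{γ ∈ SAW_n} thirdBondWeight p s t kc γ`

Cell `prim-pcint` (PAPER-2 track (iii): certified intervals for `p_c(ℤ^d)`), seat `prim-pcint-2` (gen 4); support file
(`--supports stmt-CriticalPhenomena-4575`).  Does NOT build on p205010.  Memo: `run/shared/lean/prim/pcint/REDUCTIONS.md` §B3t.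

The B3t refinement of the B3c bound (`…ChainBondReduction`): the same geodesic event `chainEvent o γ`, the same factorisation
over the path and the off-path sites, but each site is bounded with TWO kinds of units (`real_siteEvt_le_pow2` of
`…ThirdBondUnits`: `s^{sUnits + 2·#badFiber} t^{tUnits}`), giving for `1 - p² ≤ s²`, `0 ≤ t ≤ s ≤ 1`, `(1-p)(1+2p) ≤ t(1+p)`,
`p²(1-p) ≤ s²(s-t)`, `kc ≥ 2`:
`θ(p) ≤ Σ_{γ ∈ SAW_n} pⁿ (1-p)^{#chordEdges γ} s^{sTotal kc γ} t^{tTotal kc γ} ((1+s²)/2)^{cornerTotal γ}`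
(`theta_le_sum_thirdBondWeight`) and the glue `le_criticalProb_zd_of_thirdBond_le_geometric`.
-/

noncomputable section

namespace Summit.CriticalPhenomena.PercolationContinuityZ3.Theorems.Pcint

open Finset MeasureTheory Literature.Probability.Percolation Literature.Probability.LatticeModels

variable {d n : ℕ}

namespace ChainBond

/-- **The probability of the geodesic event, B3t bookkeeping**:
`P(chainEvent o γ) ≤ pⁿ (1-p)^{#chords} s^{sTotal} t^{tTotal} (s²)^{#badTimes o γ}`. [folklore] -/
theorem real_thirdEvent_le (p : unitInterval) {s t : ℝ} (hps : 1 - (p : ℝ) ^ 2 ≤ s ^ 2) (hs1 : s ≤ 1) (ht0 : 0 ≤ t)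
    (hts : t ≤ s) (htp : (1 - (p : ℝ)) * (1 + 2 * p) ≤ t * (1 + p)) (hst : (p : ℝ) ^ 2 * (1 - p) ≤ s ^ 2 * (s - t))
    {kc : ℕ} (hkc : 2 ≤ kc) (o : Orders d n) {γ : Fin n → Fin d × Bool} (hsaw : IsSAW γ) :
    (bondPercolation (zdGraph d) p).real (chainEvent o γ) ≤
      (p : ℝ) ^ n * (1 - p : ℝ) ^ (chordEdges γ).card * s ^ sTotal kc γ * t ^ tTotal kc γ * (s ^ 2) ^ (badTimes o γ).card := by
  classical
  set μ := bondPercolation (zdGraph d) p with hμ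
  have hbase := determinedBy_baseEvt γ
  have hsites : DeterminedBy (⋂ w ∈ offSites γ, siteEvt o γ w)
      (↑((offSites γ).biUnion (incEdges γ)) : Set (Sym2 (Site d))) :=
    DeterminedBy.biInter_finset fun w _ => determinedBy_siteEvt o γ w
  have hoff : ∀ w ∈ offSites γ, w ∉ pathSites γ := fun w hw => (mem_offSites.1 hw).1
  have hdisj : Disjoint (wordEdges γ ∪ chordEdges γ) ((offSites γ).biUnion (incEdges γ)) := by
    rw [disjoint_biUnion_right]
    exact fun w hw => disjoint_base_incEdges (hoff w hw)
  have hprob : μ.real (chainEvent o γ) = μ.real (baseEvt γ) * ∏ w ∈ offSites γ, μ.real (siteEvt o γ w) := by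
    rw [chainEvent, hμ, bondPercolation_real_inter_of_disjoint (zdGraph d) p (disjoint_coe.2 hdisj) hbase hsites
        hbase.measurableSet_of_finset hsites.measurableSet_of_finset,
      bondPercolation_real_biInter_eq_prod p (offSites γ) (siteEvt o γ) (incEdges γ)
        (fun w _ => determinedBy_siteEvt o γ w) (fun w hw w' _ hne => incEdges_disjoint hsaw (hoff w hw) hne)]
  have hbaseP : μ.real (baseEvt γ) = (p : ℝ) ^ n * (1 - p : ℝ) ^ (chordEdges γ).card := by
    rw [hμ, baseEvt, bondPercolation_real_open_closed _ _ (wordEdges_subset_edgeSet γ) (chordEdges_subset_edgeSet γ)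
      (IsSAW.disjoint_wordEdges_chordEdges hsaw), hsaw.card_wordEdges]
  have hsiteP : ∏ w ∈ offSites γ, μ.real (siteEvt o γ w) ≤
      ∏ w ∈ offSites γ, (s ^ (sUnits kc γ w + 2 * (badFiber o γ w).card) * t ^ tUnits kc γ w) :=
    prod_le_prod (fun w _ => measureReal_nonneg) fun w hw => by
      rw [hμ]; exact real_siteEvt_le_pow2 p hps hs1 ht0 hts htp hst hkc hsaw (hoff w hw)
  have hexp : ∏ w ∈ offSites γ, (s ^ (sUnits kc γ w + 2 * (badFiber o γ w).card) * t ^ tUnits kc γ w) =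
      s ^ sTotal kc γ * t ^ tTotal kc γ * (s ^ 2) ^ (badTimes o γ).card := by
    rw [prod_mul_distrib, prod_pow_eq_pow_sum, prod_pow_eq_pow_sum, sum_add_distrib, pow_add, sTotal, tTotal, ← mul_sum,
      pow_mul, sum_card_badFiber]
    ring
  rw [hprob, hbaseP]
  calc (p : ℝ) ^ n * (1 - p : ℝ) ^ (chordEdges γ).card * ∏ w ∈ offSites γ, μ.real (siteEvt o γ w)
      ≤ (p : ℝ) ^ n * (1 - p : ℝ) ^ (chordEdges γ).card *
          ∏ w ∈ offSites γ, (s ^ (sUnits kc γ w + 2 * (badFiber o γ w).card) * t ^ tUnits kc γ w) :=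
        mul_le_mul_of_nonneg_left hsiteP (mul_nonneg (pow_nonneg p.2.1 _) (pow_nonneg (sub_nonneg.2 p.2.2) _))
    _ = _ := by rw [hexp]; ring

/-- Per family of orders: `θ(p) ≤ Σ_{γ SAW} pⁿ (1-p)^{#chords} s^{sTotal} t^{tTotal} (s²)^{#badTimes o γ}`. [folklore] -/
theorem theta_le_sum_of_orders_third (o : Orders d n) (p : unitInterval) {s t : ℝ} (hps : 1 - (p : ℝ) ^ 2 ≤ s ^ 2) (hs1 : s ≤ 1) (ht0 : 0 ≤ t)
    (hts : t ≤ s) (htp : (1 - (p : ℝ)) * (1 + 2 * p) ≤ t * (1 + p)) (hst : (p : ℝ) ^ 2 * (1 - p) ≤ s ^ 2 * (s - t))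
    {kc : ℕ} (hkc : 2 ≤ kc) :
    theta (zdGraph d) 0 p ≤ ∑ γ ∈ sawWords d n,
      (p : ℝ) ^ n * (1 - p : ℝ) ^ (chordEdges γ).card * s ^ sTotal kc γ * t ^ tTotal kc γ * (s ^ 2) ^ (badTimes o γ).card := by
  classical
  set μ := bondPercolation (zdGraph d) p with hμ
  set bad : Set (BondConfig (Site d)) := {ω | ¬ ω ⊆ (zdGraph d).edgeSet} with hbad
  have hbad0 : μ.real bad = 0 := by
    rw [measureReal_eq_zero_iff]
    have := ProbabilityTheory.setBernoulli_ae_subset (u := (zdGraph d).edgeSet) (p := p)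
    rw [Filter.Eventually, mem_ae_iff, Set.compl_setOf] at this
    exact this
  calc theta (zdGraph d) 0 p = μ.real (percolatesAt 0) := rfl
    _ ≤ μ.real ((⋃ γ ∈ sawWords d n, chainEvent o γ) ∪ bad) :=
        measureReal_mono (percolatesAt_subset_biUnion_chainEvent o)
    _ ≤ μ.real (⋃ γ ∈ sawWords d n, chainEvent o γ) + μ.real bad := measureReal_union_le _ _
    _ = μ.real (⋃ γ ∈ sawWords d n, chainEvent o γ) := by rw [hbad0, add_zero]
    _ ≤ ∑ γ ∈ sawWords d n, μ.real (chainEvent o γ) := measureReal_biUnion_finset_le _ _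
    _ ≤ _ := sum_le_sum fun γ hγ => ?_
  rw [hμ]
  exact real_thirdEvent_le p hps hs1 ht0 hts htp hst hkc o (mem_sawWords.1 hγ)

/-- **Reduction B3t** (certificate kind `chordthird_cw`, full-information form).  For `s, t` with `1 - p² ≤ s²`,
`0 ≤ t ≤ s ≤ 1`, `(1-p)(1+2p) ≤ t(1+p)`, `p²(1-p) ≤ s²(s-t)` and a chain parameter `kc ≥ 2`:
`θ(p) ≤ Σ_{γ ∈ SAW_n} pⁿ (1-p)^{#chordEdges γ} s^{sTotal kc γ} t^{tTotal kc γ} ((1+s²)/2)^{cornerTotal γ}`. [folklore] -/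
theorem theta_le_sum_thirdBondWeight (d n : ℕ) (p : unitInterval) {s t : ℝ} (hps : 1 - (p : ℝ) ^ 2 ≤ s ^ 2) (hs1 : s ≤ 1) (ht0 : 0 ≤ t)
    (hts : t ≤ s) (htp : (1 - (p : ℝ)) * (1 + 2 * p) ≤ t * (1 + p)) (hst : (p : ℝ) ^ 2 * (1 - p) ≤ s ^ 2 * (s - t))
    {kc : ℕ} (hkc : 2 ≤ kc) :
    theta (zdGraph d) 0 p ≤ ∑ γ ∈ sawWords d n, thirdBondWeight p s t kc γ := by
  classical
  have ho := fun o : Orders d n => theta_le_sum_of_orders_third o p hps hs1 ht0 hts htp hst hkc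
  have hO : (0 : ℝ) < Fintype.card (Orders d n) := Nat.cast_pos.2 Fintype.card_pos
  have hsum := sum_le_sum fun (o : Orders d n) (_ : o ∈ univ) => ho o
  rw [sum_const, card_univ, nsmul_eq_mul, sum_comm] at hsum
  have key : ∑ γ ∈ sawWords d n, ∑ o : Orders d n,
      (p : ℝ) ^ n * (1 - p : ℝ) ^ (chordEdges γ).card * s ^ sTotal kc γ * t ^ tTotal kc γ * (s ^ 2) ^ (badTimes o γ).card
      = Fintype.card (Orders d n) * ∑ γ ∈ sawWords d n, thirdBondWeight p s t kc γ := by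
    rw [mul_sum]
    refine sum_congr rfl fun γ _ => ?_
    rw [← mul_sum, sum_orders_pow_card_badTimes, thirdBondWeight]
    ring
  rw [key] at hsum
  exact le_of_mul_le_mul_left hsum hO

/-! ### Certificate glue -/

/-- **Certificate glue (B3t).** If `Σ_{γ ∈ SAW_n} thirdBondWeight p s t kc γ ≤ C rⁿ` for all `n` with `r < 1`,
then `θ(p) = 0`. [folklore] -/
theorem theta_zd_eq_zero_of_thirdBond_le_geometric (d : ℕ) (p : unitInterval) {s t : ℝ} (hps : 1 - (p : ℝ) ^ 2 ≤ s ^ 2) (hs1 : s ≤ 1) (ht0 : 0 ≤ t)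
    (hts : t ≤ s) (htp : (1 - (p : ℝ)) * (1 + 2 * p) ≤ t * (1 + p)) (hst : (p : ℝ) ^ 2 * (1 - p) ≤ s ^ 2 * (s - t))
    {kc : ℕ} (hkc : 2 ≤ kc) {C r : ℝ}
    (hr0 : 0 ≤ r) (hr : r < 1) (h : ∀ n, ∑ γ ∈ sawWords d n, thirdBondWeight p s t kc γ ≤ C * r ^ n) :
    theta (zdGraph d) 0 p = 0 := by
  have ht : Filter.Tendsto (fun n : ℕ => C * r ^ n) Filter.atTop (nhds 0) := by
    simpa using (tendsto_pow_atTop_nhds_zero_of_lt_one hr0 hr).const_mul C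
  exact le_antisymm (ge_of_tendsto' ht fun n => (theta_le_sum_thirdBondWeight d n p hps hs1 ht0 hts htp hst hkc).trans (h n))
    measureReal_nonneg

/-- **Certificate glue (B3t), threshold form**: under the same hypothesis, `p ≤ p_c^bond(ℤ^d)`. [folklore] -/
theorem le_criticalProb_zd_of_thirdBond_le_geometric (d : ℕ) (p : unitInterval) {s t : ℝ} (hps : 1 - (p : ℝ) ^ 2 ≤ s ^ 2) (hs1 : s ≤ 1) (ht0 : 0 ≤ t)
    (hts : t ≤ s) (htp : (1 - (p : ℝ)) * (1 + 2 * p) ≤ t * (1 + p)) (hst : (p : ℝ) ^ 2 * (1 - p) ≤ s ^ 2 * (s - t))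
    {kc : ℕ} (hkc : 2 ≤ kc) {C r : ℝ}
    (hr0 : 0 ≤ r) (hr : r < 1) (h : ∀ n, ∑ γ ∈ sawWords d n, thirdBondWeight p s t kc γ ≤ C * r ^ n) :
    (p : ℝ) ≤ criticalProb (zdGraph d) 0 := by
  have h0 := theta_zd_eq_zero_of_thirdBond_le_geometric d p hps hs1 ht0 hts htp hst hkc hr0 hr h
  refine le_csInf ⟨1, Or.inr rfl⟩ ?_
  rintro q (⟨hq, hpos⟩ | hq)
  · by_contra hlt
    push Not at hlt
    have hmono := theta_mono_holds (zdGraph d) (0 : Site d) (show (⟨q, hq⟩ : unitInterval) ≤ p from hlt.le)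
    have : theta (zdGraph d) 0 ⟨q, hq⟩ ≤ 0 := hmono.trans_eq h0
    exact hpos.not_ge this
  · rw [Set.mem_singleton_iff] at hq
    rw [hq]
    exact p.2.2

end ChainBond

end Summit.CriticalPhenomena.PercolationContinuityZ3.Theorems.Pcint
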